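/-
Copyright (c) 2026 the pub-hodgecm-mathlib formalisation cell (harness21).  Prover seat hodgecm-mathlib-B-p10 (g26) — ROAD W owner (heir of B-p14 (g32)), 2026-09-01.
«R2EP HOLDS»: Rogawski's non-split Euler–Poincaré identity `RankOneEulerPoincareNonsplit`, hypothesis-free — the ROAD W fold.
-/
import Literature.NumberTheory.Rogawski1990.RankOneEulerPoincareNonsplitOfTreeActions                 -- ★ (B-p10 g26) p843833: the tree junction `rankOneEulerPoincareNonsplit_of_treeActions`
import Literature.NumberTheory.Rogawski1990.RankOneEulerPoincareNonsplitRamifiedNonEllipticOfTreeAction  -- ★ (A-p06 g28) (W6-N) FILE B: (N) from a tree action, `_local{,'}`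
import Literature.NumberTheory.Automorphic.UnitaryTwoRamifiedTreeStabilizersPlace                     -- ★ (F0P3a-p04 g14) p843891: the four (W2) stabiliser heads over `rhoVertexActPlace`
import Literature.NumberTheory.Automorphic.UnitaryTwoRamifiedTreeTorusStep                             -- ★ (B-p08 g28) p843905: `hstep` (both keyings) over ★ p843858 `rhoVertexActPlace`
import Literature.NumberTheory.Automorphic.RamifiedPlaceAntiFixedDichotomy                             -- ★ (B-p14 g32) p843768: the anti-fixed `α ∈ L_wˣ`, unit or uniformiser
import Literature.NumberTheory.Automorphic.SLTwoTreeAsLatticeTree                                      -- ★ (A-p17) `isTree_latticeTree_id_altJ`, `is{SelfDual,Modular}Lattice_id_altJ_iff`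
import Literature.NumberTheory.Automorphic.SLTwoTreeTransitive                                         -- ★ (B-p08 g28) p843742: `latticeTree_adj_root`, `exists_coe_eq_diagonal_one_uniformizer`
import Literature.NumberTheory.GaloisRepresentations.HeckeCharacter                                    -- ★ `HeckeCharacter.valued_uniformizer` (a uniformiser at every finite place)
import HarnessLib

/-!
# Rogawski's non-split Euler–Poincaré identity holds (the ROAD W fold)

Topic `NumberTheory/Rogawski1990`, namespace `Literature.NumberTheory.Rogawski1990`.  ONE THEOREM: no definition, no named fact, no instance, no notation, no `sorry`, no
hypothesis; kernel lane.  Cell `pub/hodgecm-mathlib` (D-0151), crux H413 = `stmt-HodgeConjecture-24833`, line «N6nsGerm», stub `stub_N6nsR2EP : RankOneEulerPoincareNonsplit`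
(pen F0P2-p02 (g9), ED. 1.12: `stub_N6nsR2EP := rankOneEulerPoincareNonsplit_holds`); ROAD W («R2EP-wild», F0P3a-p04 (g13) MEMO; owners B-p14 (g32) → B-p10 (g26)).
HONEST LABEL: HC_CM is proved only modulo the cell's remaining named inputs (hLiu418, h413) until rung 0 closes; THIS file is unconditional — (R2) is a
PRINTED result [Kottwitz1988, §2 Thm. 2], [Rogawski1990, §12.6], here kernel-checked for the quasi-split `U(2)` attached to a CM extension `L ∕ L⁺` at every inert
and every ramified (tame AND wild) place.

THE FOLD.  ★ `rankOneEulerPoincareNonsplit_of_treeActions` (p843833; the inert places, Kottwitz's elliptic relation (E) of either stabiliser type and the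
measure bookkeeping are inside it, over ★ p843786 ∕ ★ B-p14 p843743 ∕ ★ F0P2-p02 p843769) asks, at each place `v` of `L⁺` RAMIFIED in `L` with `w ∣ v`, for ONE action of
the one-place model `U_w = U(σ_w, (Φ₂)_w) ≤ GL₂(L_w)` on a tree with: identity ∕ multiplicativity ∕ adjacency, one vertex orbit (`hV`), one dart orbit (`hD`), a
`D ∈ GL₂(L_w)`, the two stabiliser identifications (`K = GL₂(𝒪_w)` and `K♯_D = D K D⁻¹` are the stabilisers of the base vertex and of the base edge, in one of the
two orders), and the NON-ELLIPTIC relation (N) at `(K♯_D, K, K♯_D ⊓ K)`.  We take: the tree of `SL₂(L⁺_v)` as A-p17's lattice tree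
`latticeTree id ϖ_F (0 1; −1 0)` (★ `isTree_latticeTree_id_altJ`), base dart `(v₀, v₁) = (𝒪², latt diag(1, ϖ_F))` (★ `latticeTree_adj_root`); the action
`ρ_w = rhoVertexActPlace L v w hw hα hα0 hϖF` of B-p08 (★ p843858: `rhoVertexActPlace_one ∕ _mul`, `latticeTree_adj_rhoVertexActPlace_iff`,
`exists_rhoVertexActPlace_eq{,'}` = `hV`, `exists_rhoVertexActPlace_eq_of_adj{,'}` = `hD`) through the projective descent along an anti-fixed `α ∈ L_wˣ`
(`σ_w α = −α`; ★ B-p14 `exists_units_galAdicCompletionMap_complexConj_eq_neg_of_ramified`: `α` is a UNIT — all wild places of `F_v(√u)`-type — or a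
UNIFORMISER — every tame place and the wild places of `F_v(√π)`-type); `D = D_η = glDiagonal 2 L_w ![1, η]` for a uniformiser `η` of `L_w`; the stabiliser
identifications = F0P3a-p04's (W2) heads over `ρ_w` (★ p843891 over ★ p843857): `α` a unit ⇒ `K` fixes `v₀`, `K♯_{D_η}` fixes `{v₀, v₁}` (junction type √u,
(N) by A-p06's ★ `epNonEllipticRelation_vertexEdgeLevels_of_vertexAction_local'`); `α` a uniformiser ⇒ `K♯_{D_η}` fixes `v₁`, `K` fixes `{v₁, v₀}` (type √π, base dart
reversed, (N) by ★ `…_local`); A-p06's one torus binder `hstep` (`t_η = diag(η, (σ_w η)⁻¹)` moves the base vertex to a neighbour) = B-p08's ★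
`latticeTree_adj_root_rhoVertexActPlace_of_coe_eq_diagonal{,'}` (p843905).  No `IsUnit 2` anywhere: the wild places ride the same rails.

## References
* [Kottwitz1988] R. E. Kottwitz, *Tamagawa numbers*, Ann. of Math. 127 (1988), 629–646, §2 Theorem 2.
* [Rogawski1990] J. D. Rogawski, *Automorphic Representations of Unitary Groups in Three Variables* (1990), §12.6 p. 174; §12.7 Lemma 12.7.1 p. 176.
* [Serre1980Trees] J.-P. Serre, *Trees* (1980), Ch. II §1.1–§1.4.
* [Tits1979] J. Tits, *Reductive groups over local fields*, PSPM 33.1 (1979), §2.7, §3.9.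
* [Laumon1995] G. Laumon, *Cohomology of Drinfeld Modular Varieties* I (1995), Lemma (5.3.2) p. 136.
-/

set_option autoImplicit false

noncomputable section

namespace Literature.NumberTheory.Rogawski1990

open scoped ValuativeRel Matrix MatrixGroups
open Matrix ValuativeRel NumberField IsDedekindDomain MeasureTheory Measure
open Literature.NumberTheory.Automorphic Literature.NumberTheory.Automorphic.UnitaryGroup Literature.NumberTheory.Automorphic.HermitianLatticeTree
  Literature.NumberTheory.GaloisRepresentations

set_option maxHeartbeats 400000 in
/-- **ROGAWSKI'S NON-SPLIT EULER–POINCARÉ IDENTITY, HYPOTHESIS-FREE**: `RankOneEulerPoincareNonsplit` holds — at every place `v` of `L⁺` INERT OR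
RAMIFIED (tame or wild) in the CM field `L`, for the standard maximal compact ∕ Iwahori-type levels `(K_v, K♯_v, I_v = K_v ∩ K♯_v)` of the quasi-split
`U(2)(L⁺_v)`, `m(K)⁻¹ + m(K♯)⁻¹ − m(I)⁻¹ = 1` on regular elliptic classes and `= 0` on regular non-elliptic ones (Kottwitz (1988) §2 Thm 2 via the
Bruhat–Tits tree; Rogawski (1990) §12.6 p. 174; Laumon (1995) Lemma (5.3.2)).  PROOF = the ROAD W fold: ★ `rankOneEulerPoincareNonsplit_of_treeActions`
(inert places and the (E)(N) bookkeeping already inside) applied, at each ramified `w ∣ v`, to B-p08's action `ρ_w = rhoVertexActPlace` of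
`U_w = U(σ_w, Φ₂)(L_w)` on the tree of `SL₂(L⁺_v)` (★ `UnitaryTwoRamifiedTreeAction`: `act_one ∕ act_mul ∕ act_adj`, one vertex orbit `hV`, one dart
orbit `hD`), keyed by the anti-fixed dichotomy (★ `exists_units_galAdicCompletionMap_complexConj_eq_neg_of_ramified`): `α` a UNIT ⇒ `K`-vertex `v₀ = 𝒪²`,
`K♯_{D_η}`-edge `{v₀, v₁}` (★ `forall_coe_mem_glInt_iff_rhoVertexActPlace_root_eq`, ★ `forall_coe_mem_map_conj_glDiagonal_iff_sym2_rhoVertexActPlace_eq`,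
(N) by ★ `epNonEllipticRelation_vertexEdgeLevels_of_vertexAction_local'`); `α` a UNIFORMISER ⇒ `K♯_{D_η}`-vertex `v₁ = latt diag(1, ϖ_F)`, `K`-edge
`{v₁, v₀}` (★ `…_iff_rhoVertexActPlace_next_eq`, ★ `forall_coe_mem_glInt_iff_sym2_rhoVertexActPlace_eq`, (N) by ★ `…_local`); the torus step `hstep`
is ★ `latticeTree_adj_root_rhoVertexActPlace_of_coe_eq_diagonal{,'}`, `D_η = glDiagonal 2 L_w ![1, η]` for a uniformiser `η` of `L_w`.
[cite: Kottwitz1988, §2 Theorem 2] [cite: Rogawski1990, §12.6 p. 174] [cite: Serre1980Trees, Ch. II §1.1–§1.4] [cite: Tits1979, §2.7 and §3.9]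
[cite: Laumon1995, Lemma (5.3.2) p. 136] -/
theorem rankOneEulerPoincareNonsplit_holds :
    RankOneEulerPoincareNonsplit := by
  refine rankOneEulerPoincareNonsplit_of_treeActions (fun L _ _ _ v w hw he => ?_)
  -- THE SCALARS AT `w ∣ v`: an anti-fixed `α ∈ L_wˣ` (unit or uniformiser), a uniformiser `ϖ_F` of `L⁺_v`, a uniformiser `η` of `L_w`
  obtain ⟨α, hα, hvα⟩ := exists_units_galAdicCompletionMap_complexConj_eq_neg_of_ramified L w hw he
  have hα0 : (α : w.1.adicCompletion L) ≠ 0 := α.ne_zero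
  obtain ⟨ϖF, hϖF⟩ : ∃ ϖF : v.adicCompletion ↥(maximalRealSubfield L), Valued.v ϖF = WithZero.exp (-1 : ℤ) :=
    ⟨_, HeckeCharacter.valued_uniformizer (K := ↥(maximalRealSubfield L)) (v := v)⟩
  obtain ⟨η, hη⟩ : ∃ η : (w.1.adicCompletion L)ˣ, Valued.v (η : w.1.adicCompletion L) = WithZero.exp (-1 : ℤ) :=
    ⟨_, HeckeCharacter.valued_uniformizer (K := L) (v := w.1)⟩
  haveI : IsDiscreteValuationRing 𝒪[v.adicCompletion ↥(maximalRealSubfield L)] := isDiscreteValuationRing_integer_of_compatible hϖF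
  have hϖ : IsUniformizingElement ϖF := isUniformizingElement_of_v_eq hϖF
  -- THE TREE OF `SL₂(L⁺_v)` AND ITS REFERENCE DART `(v₀, v₁) = (𝒪², latt diag(1, ϖ_F))`
  obtain ⟨g₁, hg₁, hdet₁⟩ := exists_coe_eq_diagonal_one_uniformizer (F := v.adicCompletion ↥(maximalRealSubfield L)) hϖ.ne_zero
  obtain ⟨v₀, v₁, hv₀, hv₁⟩ : ∃ v₀ v₁ : {M : Submodule 𝒪[v.adicCompletion ↥(maximalRealSubfield L)] (Fin 2 → v.adicCompletion ↥(maximalRealSubfield L)) //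
      IsSpecialLattice (RingHom.id _) ϖF !![(0 : v.adicCompletion ↥(maximalRealSubfield L)), 1; -1, 0] M},
      v₀.1 = latt (1 : Matrix (Fin 2) (Fin 2) (v.adicCompletion ↥(maximalRealSubfield L))) ∧
        v₁.1 = latt (Matrix.diagonal ![(1 : v.adicCompletion ↥(maximalRealSubfield L)), ϖF]) :=
    ⟨⟨latt (1 : Matrix (Fin 2) (Fin 2) (v.adicCompletion ↥(maximalRealSubfield L))),
        Or.inl ((isSelfDualLattice_id_altJ_iff _).2 ⟨1, by rw [Units.val_one], by rw [Units.val_one, det_one, map_one]⟩)⟩,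
      ⟨latt (Matrix.diagonal ![(1 : v.adicCompletion ↥(maximalRealSubfield L)), ϖF]),
        Or.inr ((isModularLattice_id_altJ_iff hϖ.ne_zero _).2 ⟨g₁, by rw [hg₁], by rw [hdet₁]⟩)⟩, rfl, rfl⟩
  have hX := isTree_latticeTree_id_altJ hϖ
  have h01 := latticeTree_adj_root hϖ v₀ v₁ hv₀ hv₁
  rcases hvα with hvα | hvα
  · -- `E_w = F_v(√u)`-TYPE (`α` an anti-fixed UNIT): `K`-vertex `x₀ = v₀`, `K♯_{D_η}`-edge `{v₀, v₁}`
    exact ⟨_, _, hX, rhoVertexActPlace L v w hw hα hα0 hϖF, rhoVertexActPlace_one L v w hw hα hα0 hϖF, rhoVertexActPlace_mul L v w hw hα hα0 hϖF,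
      latticeTree_adj_rhoVertexActPlace_iff L v w hw hα hα0 hϖF, v₀, v₁, h01, exists_rhoVertexActPlace_eq L v w hw hα hα0 hϖF he v₀ hv₀,
      fun _ _ hab => exists_rhoVertexActPlace_eq_of_adj L v w hw hα hα0 hϖF he v₀ v₁ hv₀ hv₁ hab, glDiagonal 2 (w.1.adicCompletion L) ![1, η],
      Or.inr ⟨forall_coe_mem_glInt_iff_rhoVertexActPlace_root_eq L v w hw hα hα0 hϖF v₀ hv₀ hvα,
        forall_coe_mem_map_conj_glDiagonal_iff_sym2_rhoVertexActPlace_eq L v w hw hα hα0 hϖF v₀ v₁ hv₀ hv₁ he hvα η hη⟩,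
      fun ν _ _ _ _ m hm γ hreg hnc => epNonEllipticRelation_vertexEdgeLevels_of_vertexAction_local' L w hw η hη ν ![1, η] hm hX
        (rhoVertexActPlace L v w hw hα hα0 hϖF) (rhoVertexActPlace_one L v w hw hα hα0 hϖF) (rhoVertexActPlace_mul L v w hw hα hα0 hϖF)
        (latticeTree_adj_rhoVertexActPlace_iff L v w hw hα hα0 hϖF) h01 (exists_rhoVertexActPlace_eq L v w hw hα hα0 hϖF he v₀ hv₀)
        (fun _ _ hab => exists_rhoVertexActPlace_eq_of_adj L v w hw hα hα0 hϖF he v₀ v₁ hv₀ hv₁ hab)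
        (forall_coe_mem_glInt_iff_rhoVertexActPlace_root_eq L v w hw hα hα0 hϖF v₀ hv₀ hvα)
        (forall_coe_mem_map_conj_glDiagonal_iff_sym2_rhoVertexActPlace_eq L v w hw hα hα0 hϖF v₀ v₁ hv₀ hv₁ he hvα η hη)
        (latticeTree_adj_root_rhoVertexActPlace_of_coe_eq_diagonal L v w hw hα hα0 hϖF he η hη v₀ hv₀) γ hreg hnc⟩
  · -- `E_w = F_v(√π)`-TYPE (`α` an anti-fixed UNIFORMISER): `K♯_{D_η}`-vertex `x₀ = v₁`, `K`-edge `{v₁, v₀}`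
    exact ⟨_, _, hX, rhoVertexActPlace L v w hw hα hα0 hϖF, rhoVertexActPlace_one L v w hw hα hα0 hϖF, rhoVertexActPlace_mul L v w hw hα hα0 hϖF,
      latticeTree_adj_rhoVertexActPlace_iff L v w hw hα hα0 hϖF, v₁, v₀, h01.symm, exists_rhoVertexActPlace_eq' L v w hw hα hα0 hϖF he v₁,
      fun _ _ hab => exists_rhoVertexActPlace_eq_of_adj' L v w hw hα hα0 hϖF he v₁ v₀ hv₁ hv₀ hab, glDiagonal 2 (w.1.adicCompletion L) ![1, η],
      Or.inl ⟨forall_coe_mem_map_conj_glDiagonal_iff_rhoVertexActPlace_next_eq L v w hw hα hα0 hϖF v₁ hv₁ he hvα η hη,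
        forall_coe_mem_glInt_iff_sym2_rhoVertexActPlace_eq L v w hw hα hα0 hϖF v₀ v₁ hv₀ hv₁ he hvα⟩,
      fun ν _ _ _ _ m hm γ hreg hnc => epNonEllipticRelation_vertexEdgeLevels_of_vertexAction_local L w hw η hη ν ![1, η] hm hX
        (rhoVertexActPlace L v w hw hα hα0 hϖF) (rhoVertexActPlace_one L v w hw hα hα0 hϖF) (rhoVertexActPlace_mul L v w hw hα hα0 hϖF)
        (latticeTree_adj_rhoVertexActPlace_iff L v w hw hα hα0 hϖF) h01.symm (exists_rhoVertexActPlace_eq' L v w hw hα hα0 hϖF he v₁)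
        (fun _ _ hab => exists_rhoVertexActPlace_eq_of_adj' L v w hw hα hα0 hϖF he v₁ v₀ hv₁ hv₀ hab)
        (forall_coe_mem_map_conj_glDiagonal_iff_rhoVertexActPlace_next_eq L v w hw hα hα0 hϖF v₁ hv₁ he hvα η hη)
        (forall_coe_mem_glInt_iff_sym2_rhoVertexActPlace_eq L v w hw hα hα0 hϖF v₀ v₁ hv₀ hv₁ he hvα)
        (latticeTree_adj_root_rhoVertexActPlace_of_coe_eq_diagonal' L v w hw hα hα0 hϖF he η hη v₁ hv₁) γ hreg hnc⟩

end Literature.NumberTheory.Rogawski1990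

end
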